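import Mathlib
import Summits.ResolutionOfSingularities.ResolutionOfSingularities.Theorems.WeightedInvariantLocalWeightedDropPolyDescentBridge
import Summits.ResolutionOfSingularities.ResolutionOfSingularities.Theorems.WeightedInvariantLocalWeightedDropPolyDescentPrepExists
import Summits.ResolutionOfSingularities.ResolutionOfSingularities.Theorems.WeightedInvariantLocalWeightedDropPolyDescentCompare

/-!
# `WeightedInvariant.LocalWeightedDrop`, residual T″|₄ (skeleton v32, registered stub `stub_spaceNCRankDrop`): TOT2-LINE piece S-E2,
# (E2-c) THE COUNT-GAME BRIDGE — the successor monic forms ARE the succT-labels, at the GERM level (`m = 2`)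

Crux item stmt-ResolutionOfSingularities-8899 `LocalWeightedDrop` (route `ResolutionOfSingularities/WeightedInvariant`); line TOT2-LINE v1 of
res-L1-w43-lead-1 (§5 (E2-c)/(E2-d)), dealt to res-L1-w43-stub-2 (res-L1-w43-plan-1 DEALS gen 10 #9); companion of …TOT2BridgePoint (p530471) and
…TOT2BridgeCurve (p531619).  [OURS · L1 W4.3, chain w43, res-L1-w43-stub-2 (gen 4).  The EQUATIONS behind the free-move `iff`s of ρ-B
(…PolyDescentBridgeSlices `won_pointSucc_zero_iff` …, res-type-061 / res-D-pv-058; res-type-083's `won_monic_scale_iff`): in the count game there are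
no free moves, so the (E2-d) chain argument needs the successor GERM written as `unit · Θ^*(monic form of the succT-label)` with an EXPLICIT legal
`Θ` fixing the letters up to scalars — which the strategy then undoes inside its next move.  Nothing here is a statement of any manuscript;
AI-written, gate-accepted means sorry-free with standard axioms.  Definition-free.]

* `subst_scaleLast_monicForm` (every `m`): `y ↦ γ⁻¹y` maps `y^d + Σ T_j y^j` to `γ^{-d} · (y^d + Σ γ^{d−j} T_j y^j)` (+ the legality of this `Θ`).
* `monicForm_C_pow_mul_eq` (every `m`): `y^d + Σ γ^{d−j}·(T_j∘θ) y^j = γ^d · (scale_γ ∘ extend θ)^*(y^d + Σ T_j y^j)` for a plane change `θ`.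
* `m = 2`, the four successors of …TOT2BridgePoint / …TOT2BridgeCurve as labels (via BridgeSlices):
  `monicForm_pointSucc_zero` (slot `0`, `c₀ ≠ 0`: label `blowOneT d (shearT (C (c₁/c₀)) A)`), `monicForm_pointSucc_one` (slot `1` at `c₀ = 0`:
  `blowTwoT d A`), `monicForm_curveSucc_zero` / `monicForm_curveSucc_one` (labels `A′` = `divOneT`/`divTwoT`).
* `monicForm_blowOneT_eq_recentre_prep` (the `λ ≠ 0` branch of `succT`): the monic form of `blowOneT d Y` is the re-centring
  `y ↦ y − χ′(u)` of the monic form of the succT-label `blowOneT d (prep d Y)` (`blowOneT_shift`, ρ-P `stub_polyPrep`, `subst_shear_monicForm`).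
-/

set_option linter.dupNamespace false -- mandated namespace of this single-conjunct summit
set_option autoImplicit false

noncomputable section

namespace Summit.ResolutionOfSingularities.ResolutionOfSingularities.Theorems

open Literature.AlgebraicGeometry.Resolution
open Literature.AlgebraicGeometry.Resolution.CobordantGame

namespace PolyDescent

open MvPowerSeries MonicDescent WildMonic

variable {k : Type} [Field k] {m d : ℕ}

/-! ## `y ↦ γ⁻¹ y` on a monic form (every `m`) -/

/-- The scaling `y ↦ γ⁻¹ y` (other letters fixed) has zero constant terms. -/
theorem constantCoeff_scaleLast (γ : k) (l : Fin (m + 1)) :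
    constantCoeff ((fun l : Fin (m + 1) => if l = Fin.last m then C γ⁻¹ * X l else (X l : MvPowerSeries (Fin (m + 1)) k)) l) = 0 := by
  dsimp only
  split_ifs <;> simp [constantCoeff_X]

/-- The scaling `y ↦ γ⁻¹ y` has invertible linear part (`γ ≠ 0`). -/
theorem isUnit_det_scaleLast {γ : k} (hγ : γ ≠ 0) :
    IsUnit (FormalCoordChange.linMat
      (fun l : Fin (m + 1) => if l = Fin.last m then C γ⁻¹ * X l else (X l : MvPowerSeries (Fin (m + 1)) k))).det := by
  have hM : FormalCoordChange.linMat
      (fun l : Fin (m + 1) => if l = Fin.last m then C γ⁻¹ * X l else (X l : MvPowerSeries (Fin (m + 1)) k)) =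
      Matrix.diagonal (fun j : Fin (m + 1) => if j = Fin.last m then γ⁻¹ else 1) := by
    ext i j
    rw [FormalCoordChange.linMat, Matrix.of_apply, Matrix.diagonal_apply]
    by_cases hi : i = Fin.last m
    · simp only [hi, if_true, coeff_C_mul, coeff_X, Finsupp.single_eq_single_iff, one_ne_zero, and_true, and_self, or_false]
      by_cases hj : Fin.last m = j
      · subst hj; simp
      · rw [if_neg (fun h => hj h.symm), if_neg hj, mul_zero]
    · simp only [if_neg hi, coeff_X, Finsupp.single_eq_single_iff, one_ne_zero, and_true, and_self, or_false]
      by_cases hj : i = j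
      · subst hj; simp
      · rw [if_neg (fun h => hj h.symm), if_neg hj]
  rw [hM, Matrix.det_diagonal]
  exact isUnit_iff_ne_zero.mpr (Finset.prod_ne_zero_iff.mpr fun j _ => by split_ifs; exacts [inv_ne_zero hγ, one_ne_zero])

/-- Renaming a constant of the plane into `k⟦x', y⟧`. -/
theorem rename_succAboveEmb_C (a : k) :
    rename (Fin.succAboveEmb (Fin.last m)) (C a : MvPowerSeries (Fin m) k) = (C a : MvPowerSeries (Fin (m + 1)) k) := by
  rw [← monomial_zero_eq_C_apply, rename_monomial, Finsupp.mapDomain_zero, monomial_zero_eq_C_apply]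

/-- **`y ↦ γ⁻¹ y` ON A MONIC FORM** (every `m`, the identity behind res-type-083's `won_monic_scale_iff`):
`(y^d + Σ T_j y^j) ∘ (y ↦ γ⁻¹y) = γ^{-d} · (y^d + Σ γ^{d−j} T_j y^j)`. -/
theorem subst_scaleLast_monicForm {γ : k} (hγ : γ ≠ 0) (T : Fin d → MvPowerSeries (Fin m) k) :
    subst (fun l : Fin (m + 1) => if l = Fin.last m then C γ⁻¹ * X l else (X l : MvPowerSeries (Fin (m + 1)) k))
        (X (Fin.last m) ^ d + ∑ j : Fin d, rename (Fin.succAboveEmb (Fin.last m)) (T j) * X (Fin.last m) ^ (j : ℕ)) =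
      C (γ⁻¹ ^ d) * (X (Fin.last m) ^ d +
        ∑ j : Fin d, rename (Fin.succAboveEmb (Fin.last m)) (C (γ ^ (d - (j : ℕ))) * T j) * X (Fin.last m) ^ (j : ℕ)) := by
  set Ψ : Fin (m + 1) → MvPowerSeries (Fin (m + 1)) k :=
    fun l => if l = Fin.last m then C γ⁻¹ * X l else X l with hΨ
  have hΨlast : Ψ (Fin.last m) = C γ⁻¹ * X (Fin.last m) := by simp [hΨ]
  have hΨcast : ∀ i : Fin m, Ψ (Fin.castSucc i) = X (Fin.castSucc i) := fun i => by
    show (if Fin.castSucc i = Fin.last m then C γ⁻¹ * X (Fin.castSucc i) else X (Fin.castSucc i)) = X (Fin.castSucc i)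
    rw [if_neg (Fin.castSucc_lt_last i).ne]
  have hΨ0 : ∀ j, constantCoeff (Ψ j) = 0 := constantCoeff_scaleLast γ
  have hΨs : HasSubst Ψ := hasSubst_of_constantCoeff_zero hΨ0
  have hren : ∀ F : MvPowerSeries (Fin m) k,
      subst Ψ (rename (Fin.succAboveEmb (Fin.last m)) F) = rename (Fin.succAboveEmb (Fin.last m)) F := fun F => by
    rw [subst_rename_eq _ Ψ hΨ0 F, rename_eq_subst]
    congr 1
    funext i
    have hi : (Fin.succAboveEmb (Fin.last m)) i = Fin.castSucc i := by rw [Fin.coe_succAboveEmb, Fin.succAbove_last]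
    rw [Function.comp_apply, hi, hΨcast]
  rw [← coe_substAlgHom hΨs, map_add, map_pow, map_sum, coe_substAlgHom, subst_X hΨs, hΨlast, mul_add, mul_pow, ← map_pow,
    Finset.mul_sum]
  congr 1
  refine Finset.sum_congr rfl fun j _ => ?_
  rw [← coe_substAlgHom hΨs, map_mul, map_pow, coe_substAlgHom, hren, subst_X hΨs, hΨlast, map_mul (rename _),
    rename_succAboveEmb_C, mul_pow, ← map_pow]
  have hjd : (j : ℕ) ≤ d := j.2.le
  have hγj : (γ⁻¹ ^ d : k) * γ ^ (d - (j : ℕ)) = γ⁻¹ ^ (j : ℕ) := by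
    calc (γ⁻¹ ^ d : k) * γ ^ (d - (j : ℕ)) = γ⁻¹ ^ (d - (j : ℕ) + (j : ℕ)) * γ ^ (d - (j : ℕ)) := by rw [Nat.sub_add_cancel hjd]
      _ = γ⁻¹ ^ (j : ℕ) * (γ⁻¹ * γ) ^ (d - (j : ℕ)) := by rw [pow_add, mul_pow]; ring
      _ = γ⁻¹ ^ (j : ℕ) := by rw [inv_mul_cancel₀ hγ, one_pow, mul_one]
  calc rename (Fin.succAboveEmb (Fin.last m)) (T j) * (C (γ⁻¹ ^ (j : ℕ)) * X (Fin.last m) ^ (j : ℕ))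
      = C (γ⁻¹ ^ d * γ ^ (d - (j : ℕ))) * rename (Fin.succAboveEmb (Fin.last m)) (T j) * X (Fin.last m) ^ (j : ℕ) := by
        rw [hγj]; ring
    _ = C (γ⁻¹ ^ d) * (C (γ ^ (d - (j : ℕ))) * rename (Fin.succAboveEmb (Fin.last m)) (T j) * X (Fin.last m) ^ (j : ℕ)) := by
        rw [map_mul]; ring

/-- **RESCALED COEFFICIENTS AS A SUBSTITUTION** (every `m`): for a plane change `θ` (zero constants) and `γ ≠ 0`,
`y^d + Σ γ^{d−j}·(T_j ∘ θ) y^j = γ^d · (y ↦ γ⁻¹y)^* (extend θ)^* (y^d + Σ T_j y^j)`. -/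
theorem monicForm_C_pow_mul_eq {γ : k} (hγ : γ ≠ 0) (θ : Fin m → MvPowerSeries (Fin m) k) (hθ : ∀ i, constantCoeff (θ i) = 0)
    (T : Fin d → MvPowerSeries (Fin m) k) :
    X (Fin.last m) ^ d + ∑ j : Fin d, rename (Fin.succAboveEmb (Fin.last m)) (C (γ ^ (d - (j : ℕ))) * subst θ (T j)) * X (Fin.last m) ^ (j : ℕ) =
      C (γ ^ d) * subst (fun l : Fin (m + 1) => if l = Fin.last m then C γ⁻¹ * X l else (X l : MvPowerSeries (Fin (m + 1)) k))
        (subst (fun l : Fin (m + 1) => Fin.lastCases (motive := fun _ => MvPowerSeries (Fin (m + 1)) k) (X (Fin.last m))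
            (fun i => rename (Fin.succAboveEmb (Fin.last m)) (θ i)) l)
          (X (Fin.last m) ^ d + ∑ j : Fin d, rename (Fin.succAboveEmb (Fin.last m)) (T j) * X (Fin.last m) ^ (j : ℕ))) := by
  rw [subst_extendLast_monicForm θ hθ T, subst_scaleLast_monicForm hγ, ← mul_assoc, ← map_mul, ← mul_pow, mul_inv_cancel₀ hγ, one_pow,
    map_one, one_mul]

/-! ## `m = 2`: the successors of the point move as labels -/

section Point

variable (c : Fin 2 → k) (A : Fin d → MvPowerSeries (Fin 2) k) (B : Fin d → MvPowerSeries (Fin (2 + 1)) k)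
  (hB : ∀ j : Fin d, subst (CobordantChart.chart (fun _ : Fin 2 => 1) c) (A j) = X 0 ^ (d - (j : ℕ) + 1) * B j)

include hB in
/-- **POINT MOVE, SLOT `0` (`c₀ ≠ 0`) AS A LABEL**: the successor monic form of …TOT2BridgePoint is
`c₀^d · Θ^*(monic form of blowOneT d (shearT (C (c₁/c₀)) A))`, `Θ = (y ↦ c₀⁻¹y) ∘ extend(diag(c₀, c₀⁻¹))`. [OURS · L1 W4.3] -/
theorem monicForm_pointSucc_zero (hc : c 0 ≠ 0) :
    X (Fin.last 2) ^ d + ∑ j : Fin d, rename (Fin.succAboveEmb (Fin.last 2)) (TupleGame.slice (0 : Fin 2) (X 0 * B j)) * X (Fin.last 2) ^ (j : ℕ) =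
      C (c 0 ^ d) * subst (fun l : Fin (2 + 1) => if l = Fin.last 2 then C (c 0)⁻¹ * X l else (X l : MvPowerSeries (Fin (2 + 1)) k))
        (subst (fun l : Fin (2 + 1) => Fin.lastCases (motive := fun _ => MvPowerSeries (Fin (2 + 1)) k) (X (Fin.last 2))
            (fun i => rename (Fin.succAboveEmb (Fin.last 2))
              ((fun l : Fin 2 => if l = 0 then C (c 0) * X 0 else C (c 0)⁻¹ * (X 1 : MvPowerSeries (Fin 2) k)) i)) l)
          (X (Fin.last 2) ^ d +
            ∑ j : Fin d, rename (Fin.succAboveEmb (Fin.last 2)) (blowOneT d (shearT (C (c 1 / c 0)) A) j) * X (Fin.last 2) ^ (j : ℕ))) := by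
  simp only [slice_zero_eq_blowOneT c A B hB hc]
  exact monicForm_C_pow_mul_eq hc _ (PureDescent.constantCoeff_diag (c 0) (c 0)⁻¹) _

include hB in
/-- **POINT MOVE, SLOT `1` AT `c₀ = 0` (`c₁ ≠ 0`) AS A LABEL**: the successor monic form is `c₁^d · Θ^*(monic form of blowTwoT d A)`,
`Θ = (y ↦ c₁⁻¹y) ∘ extend(swap-diag(c₁⁻¹, c₁))`. [OURS · L1 W4.3] -/
theorem monicForm_pointSucc_one (hc0 : c 0 = 0) (hc : c 1 ≠ 0) :
    X (Fin.last 2) ^ d + ∑ j : Fin d, rename (Fin.succAboveEmb (Fin.last 2)) (TupleGame.slice (1 : Fin 2) (X 0 * B j)) * X (Fin.last 2) ^ (j : ℕ) =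
      C (c 1 ^ d) * subst (fun l : Fin (2 + 1) => if l = Fin.last 2 then C (c 1)⁻¹ * X l else (X l : MvPowerSeries (Fin (2 + 1)) k))
        (subst (fun l : Fin (2 + 1) => Fin.lastCases (motive := fun _ => MvPowerSeries (Fin (2 + 1)) k) (X (Fin.last 2))
            (fun i => rename (Fin.succAboveEmb (Fin.last 2))
              ((fun l : Fin 2 => if l = 0 then C (c 1)⁻¹ * X 1 else C (c 1) * (X 0 : MvPowerSeries (Fin 2) k)) i)) l)
          (X (Fin.last 2) ^ d + ∑ j : Fin d, rename (Fin.succAboveEmb (Fin.last 2)) (blowTwoT d A j) * X (Fin.last 2) ^ (j : ℕ))) := by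
  simp only [slice_one_eq_blowTwoT c A B hB hc0 hc]
  exact monicForm_C_pow_mul_eq hc _ (PureDescent.constantCoeff_swapDiag (c 1)⁻¹ (c 1)) _

end Point

/-! ## `m = 2`: the successors of the curve moves as labels -/

/-- **CURVE MOVE `V(y,u₁)` AS A LABEL**: the successor monic form of …TOT2BridgeCurve (`i = 0`) is `c^d · Θ^*(monic form of A′)`,
`Θ = (y ↦ c⁻¹y) ∘ extend(diag(c, 1))`. [OURS · L1 W4.3] -/
theorem monicForm_curveSucc_zero {ci : k} (hci : ci ≠ 0) (A' : Fin d → MvPowerSeries (Fin 2) k) :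
    X (Fin.last 2) ^ d + ∑ j : Fin d, rename (Fin.succAboveEmb (Fin.last 2))
        (C (ci ^ (d - (j : ℕ))) * TupleGame.slice (0 : Fin 2) (subst (CobordantChart.chart (fun l : Fin 2 => if l = 0 then 1 else 0)
          (fun l : Fin 2 => if l = 0 then ci else 0)) (A' j))) * X (Fin.last 2) ^ (j : ℕ) =
      C (ci ^ d) * subst (fun l : Fin (2 + 1) => if l = Fin.last 2 then C ci⁻¹ * X l else (X l : MvPowerSeries (Fin (2 + 1)) k))
        (subst (fun l : Fin (2 + 1) => Fin.lastCases (motive := fun _ => MvPowerSeries (Fin (2 + 1)) k) (X (Fin.last 2))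
            (fun i => rename (Fin.succAboveEmb (Fin.last 2))
              ((fun l : Fin 2 => if l = 0 then C ci * X 0 else C 1 * (X 1 : MvPowerSeries (Fin 2) k)) i)) l)
          (X (Fin.last 2) ^ d + ∑ j : Fin d, rename (Fin.succAboveEmb (Fin.last 2)) (A' j) * X (Fin.last 2) ^ (j : ℕ))) := by
  simp only [curveSlice_zero_eq']
  exact monicForm_C_pow_mul_eq hci _ (PureDescent.constantCoeff_diag ci 1) _

/-- **CURVE MOVE `V(y,u₂)` AS A LABEL**: the successor monic form of …TOT2BridgeCurve (`i = 1`) is `c^d · Θ^*(monic form of A′)`,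
`Θ = (y ↦ c⁻¹y) ∘ extend(swap-diag(1, c))`. [OURS · L1 W4.3] -/
theorem monicForm_curveSucc_one {ci : k} (hci : ci ≠ 0) (A' : Fin d → MvPowerSeries (Fin 2) k) :
    X (Fin.last 2) ^ d + ∑ j : Fin d, rename (Fin.succAboveEmb (Fin.last 2))
        (C (ci ^ (d - (j : ℕ))) * TupleGame.slice (1 : Fin 2) (subst (CobordantChart.chart (fun l : Fin 2 => if l = 1 then 1 else 0)
          (fun l : Fin 2 => if l = 1 then ci else 0)) (A' j))) * X (Fin.last 2) ^ (j : ℕ) =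
      C (ci ^ d) * subst (fun l : Fin (2 + 1) => if l = Fin.last 2 then C ci⁻¹ * X l else (X l : MvPowerSeries (Fin (2 + 1)) k))
        (subst (fun l : Fin (2 + 1) => Fin.lastCases (motive := fun _ => MvPowerSeries (Fin (2 + 1)) k) (X (Fin.last 2))
            (fun i => rename (Fin.succAboveEmb (Fin.last 2))
              ((fun l : Fin 2 => if l = 0 then C 1 * X 1 else C ci * (X 0 : MvPowerSeries (Fin 2) k)) i)) l)
          (X (Fin.last 2) ^ d + ∑ j : Fin d, rename (Fin.succAboveEmb (Fin.last 2)) (A' j) * X (Fin.last 2) ^ (j : ℕ))) := by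
  simp only [curveSlice_one_eq']
  exact monicForm_C_pow_mul_eq hci _ (PureDescent.constantCoeff_swapDiag 1 ci) _

/-! ## The `λ ≠ 0` branch of `succT`: un-preparing the label is a re-centring -/

/-- **THE PREPARED succT-LABEL**: for a positive label `Y` (`0 < d`), with `χ := prepPsi d Y` (ρ-P `stub_polyPrep`) and `χ′ := blowOne 1 χ`
(`χ′(0) = 0`), the monic form of `blowOneT d Y` is the RE-CENTRING `y ↦ y − χ′(u)` of the monic form of the succT-label `blowOneT d (prep d Y)`
(`blowOneT_shift` + `subst_shear_monicForm`).  So the `λ ≠ 0` successor of …TOT2BridgePoint is `unit · Θ^*(monic form of the label)` with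
`Θ` = rescaling ∘ this re-centring, a legal change fixing every letter `u₁, u₂, s`. [OURS · L1 W4.3] -/
theorem monicForm_blowOneT_eq_recentre_prep (hd : 0 < d) (Y : Fin d → MvPowerSeries (Fin 2) k) (hY : IsPosT d Y) :
    constantCoeff (blowOne 1 (prepPsi d Y)) = 0 ∧
    X (Fin.last 2) ^ d + ∑ j : Fin d, rename (Fin.succAboveEmb (Fin.last 2)) (blowOneT d Y j) * X (Fin.last 2) ^ (j : ℕ) =
      subst (fun l : Fin (2 + 1) => if l = Fin.last 2 then X (Fin.last 2) + rename (Fin.succAboveEmb (Fin.last 2)) (-blowOne 1 (prepPsi d Y))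
          else (X l : MvPowerSeries (Fin (2 + 1)) k))
        (X (Fin.last 2) ^ d + ∑ j : Fin d, rename (Fin.succAboveEmb (Fin.last 2)) (blowOneT d (prep d Y) j) * X (Fin.last 2) ^ (j : ℕ)) := by
  obtain ⟨hχ0, hposB, -, -⟩ := isPrepRecentring_prepPsi (stub_polyPrep k d hd Y hY)
  set χ := prepPsi d Y with hχ
  have hBdef : prep d Y = shift d Y χ := rfl
  have hχ1 : (1 : ℕ∞) ≤ χ.order := nat_le_order fun e he => by
    have he0 : e = 0 := by
      have : e.degree = 0 := by exact_mod_cast Nat.lt_one_iff.mp (by exact_mod_cast he)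
      exact (Finsupp.degree_eq_zero_iff e).mp this
    rw [he0, coeff_zero_eq_constantCoeff_apply, hχ0]
  have hcomm : blowOneT d (prep d Y) = shift d (blowOneT d Y) (blowOne 1 χ) := by
    rw [hBdef]; exact blowOneT_shift Y χ (fun j => (hY j).le) hχ1
  have hchi1 : constantCoeff (blowOne 1 χ) = 0 := by
    rw [constantCoeff_blowOne_one_eq]
    exact coeff_single_one_eq_zero_of_isPosT_shift hd hY hχ0 (hBdef ▸ hposB) 0
  refine ⟨hchi1, ?_⟩
  rw [hcomm, subst_shear_monicForm (-blowOne 1 χ) (by rw [map_neg, hchi1, neg_zero]) (shift d (blowOneT d Y) (blowOne 1 χ)),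
    shift_shift_neg]

end PolyDescent

end Summit.ResolutionOfSingularities.ResolutionOfSingularities.Theorems

end
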